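import Mathlib.Analysis.SpecificLimits.Basic
import Mathlib.Topology.Algebra.InfiniteSum.NatInt
import Mathlib.Topology.Algebra.InfiniteSum.Order
import Mathlib.Topology.Algebra.InfiniteSum.Real
import Mathlib.Data.Nat.Choose.Sum
import Mathlib.Tactic
import Literature.Barriers.CriticalPhenomena.RigorousRGSmallParameterHHWThm22CertArith
import HarnessLib

/-!
# Hara–Hattori–Watanabe 2001, Theorem 2.2: certificate soundness, part 2 (the tail of (5.6) and the `S` step)

Second theorem-only file on the meaning of `Thm22Cert.Cfg.check` (Proposition 5.1 of
Hara–Hattori–Watanabe, CMP 220 (2001), §5.2), for an ABSTRACT coefficient sequence `a : ℕ → ℝ`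
under the hypotheses the truncation argument uses — `a_0 = 1`, `a_n ≥ 0` and Newman's inequality
(A.6) `a_{m+n} ≤ a_m a_n` (for the trajectory these are `taylorA_zero`, `taylorA_nonneg` and the
named fact `HaraHattoriWatanabe2001_eqA6` of `…HHWNewmanBounds.lean`). Objects are the tree's
`bOf` ((5.4)), `tildeCoef` and `beta (√2)` ((5.6)); the `m`-th term of (5.6) is written
`(β/2)^m b_{m+n}(a) tildeCoef m n` (the order of `taylorA_traj_succ`), and the tail majorant of
(5.26)–(5.27) is `𝔘_m = tildeCoef m n (β/2)^m (c/2)^{m+n} a_M a_1^{m+n-M}` (written out in full in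
the statements; used only for `m + n > 2M`, where the natural subtraction is honest).

Proved: (5.3) `a_n ≤ a_1ⁿ`; **(5.26)** `b_k ≤ (c/2)^k a_M a_1^{k-M}` (`k > 2M`) for abstract
sequences (the tree's `bOf_le_pow_mul` is its trajectory instance in ratio form); the ratio
recursion of `𝔘` and its eventual geometric decay, hence the **summability of (5.6)** and the tail
estimate `Σ_{m ≥ m₀} ≤ Σ_{m₀ ≤ m < m₁} 𝔘_m + 𝔘_{m₁}/(1-q)` ((5.25)–(5.29)); and the `S` step of
Proposition 5.1 against the checker: `bLo n ≤ b_n O ≤ bHi n` for `n ≤ 2M` (`O = 2^P`), the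
coefficients beyond `M` being dropped below and bounded above through (A.6) (`loExt`, `hiExt`).
-/

noncomputable section

namespace Literature.Barriers.CriticalPhenomena.HierarchicalRG.Thm22Cert

open Finset

variable {a : ℕ → ℝ}

/-! ### Consequences of (A.6) for an abstract sequence -/

/-- (5.3) from (A.6): `a_n ≤ a_1ⁿ`. [cite: HaraHattoriWatanabe2001, §5.1 eq. (5.3)] -/
theorem le_pow_of_submul (h0 : a 0 = 1) (hnn : ∀ n, 0 ≤ a n) (hA6 : ∀ m n, a (m + n) ≤ a m * a n)
    (n : ℕ) : a n ≤ a 1 ^ n := by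
  induction n with
  | zero => simp [h0]
  | succ n ih =>
    calc a (n + 1) = a (1 + n) := by rw [add_comm]
      _ ≤ a 1 * a n := hA6 1 n
      _ ≤ a 1 * a 1 ^ n := mul_le_mul_of_nonneg_left ih (hnn 1)
      _ = a 1 ^ (n + 1) := by ring

/-- The term bound behind (5.26): for `k > 2M` and `l ≤ k`, `a_l a_{k-l} ≤ a_M a_1^{k-M}`.
[cite: HaraHattoriWatanabe2001, §5.2 eq. (5.26)] -/
theorem mul_le_of_submul (h0 : a 0 = 1) (hnn : ∀ n, 0 ≤ a n) (hA6 : ∀ m n, a (m + n) ≤ a m * a n)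
    {M k l : ℕ} (hk : 2 * M < k) (hl : l ≤ k) : a l * a (k - l) ≤ a M * a 1 ^ (k - M) := by
  have h1 : 0 ≤ a 1 := hnn 1
  have hp := le_pow_of_submul h0 hnn hA6
  by_cases hM : M < l
  · have e : l = M + (l - M) := by omega
    calc a l * a (k - l) = a (M + (l - M)) * a (k - l) := by rw [← e]
      _ ≤ (a M * a (l - M)) * a (k - l) := mul_le_mul_of_nonneg_right (hA6 _ _) (hnn _)
      _ ≤ (a M * a 1 ^ (l - M)) * a 1 ^ (k - l) := by
          apply mul_le_mul (mul_le_mul_of_nonneg_left (hp _) (hnn M)) (hp _) (hnn _)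
          exact mul_nonneg (hnn M) (pow_nonneg h1 _)
      _ = a M * a 1 ^ (k - M) := by
          rw [mul_assoc, ← pow_add, show l - M + (k - l) = k - M by omega]
  · push Not at hM
    have e : k - l = M + (k - l - M) := by omega
    calc a l * a (k - l) = a l * a (M + (k - l - M)) := by rw [← e]
      _ ≤ a l * (a M * a (k - l - M)) := mul_le_mul_of_nonneg_left (hA6 _ _) (hnn _)
      _ ≤ a 1 ^ l * (a M * a 1 ^ (k - l - M)) := by
          apply mul_le_mul (hp _) (mul_le_mul_of_nonneg_left (hp _) (hnn M)) ?_ (pow_nonneg h1 _)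
          exact mul_nonneg (hnn M) (hnn _)
      _ = a M * a 1 ^ (k - M) := by
          rw [mul_comm, mul_assoc, ← pow_add, show k - l - M + l = k - M by omega]

/-- `b_k(a) ≥ 0` for a nonnegative sequence. [folklore] -/
theorem bOf_nonneg_of_nonneg (hnn : ∀ n, 0 ≤ a n) (k : ℕ) : 0 ≤ bOf a k := by
  unfold bOf
  refine mul_nonneg (by positivity) (sum_nonneg fun l _ => ?_)
  exact mul_nonneg (mul_nonneg (by positivity) (hnn _)) (hnn _)

/-- **(5.26) for an abstract sequence**: for `k > 2M`, `b_k ≤ (c/2)^k a_M a_1^{k-M}` (`c = √2`).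
[cite: HaraHattoriWatanabe2001, §5.2 eq. (5.26)] -/
theorem bOf_le_of_submul (h0 : a 0 = 1) (hnn : ∀ n, 0 ≤ a n) (hA6 : ∀ m n, a (m + n) ≤ a m * a n)
    {M k : ℕ} (hk : 2 * M < k) : bOf a k ≤ (Real.sqrt 2 / 2) ^ k * (a M * a 1 ^ (k - M)) := by
  unfold bOf
  have hsum : ∑ l ∈ range (k + 1), (k.choose l : ℝ) * a l * a (k - l) ≤
      ∑ l ∈ range (k + 1), (k.choose l : ℝ) * (a M * a 1 ^ (k - M)) := by
    refine sum_le_sum fun l hl => ?_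
    rw [mul_assoc]
    exact mul_le_mul_of_nonneg_left
      (mul_le_of_submul h0 hnn hA6 hk (by simpa [Nat.lt_succ_iff] using hl)) (by positivity)
  have hbin : ∑ l ∈ range (k + 1), (k.choose l : ℝ) * (a M * a 1 ^ (k - M)) =
      2 ^ k * (a M * a 1 ^ (k - M)) := by
    rw [← sum_mul]
    congr 1
    exact_mod_cast Nat.sum_range_choose k
  calc (Real.sqrt 2 / 4) ^ k * ∑ l ∈ range (k + 1), (k.choose l : ℝ) * a l * a (k - l)
      ≤ (Real.sqrt 2 / 4) ^ k * (2 ^ k * (a M * a 1 ^ (k - M))) := by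
        rw [← hbin]; exact mul_le_mul_of_nonneg_left hsum (by positivity)
    _ = (Real.sqrt 2 / 2) ^ k * (a M * a 1 ^ (k - M)) := by
        rw [← mul_assoc, ← mul_pow]; congr 2; ring

/-- The terms of (5.6) are `≥ 0`. [folklore] -/
theorem term_nonneg (hnn : ∀ n, 0 ≤ a n) (n m : ℕ) : 0 ≤ ((beta (Real.sqrt 2) / 2) ^ m * bOf a (m + n) * tildeCoef m n) := by
  have := beta_sqrt_two_pos
  exact mul_nonneg (mul_nonneg (by positivity) (bOf_nonneg_of_nonneg hnn _)) (tildeCoef_nonneg _ _)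

/-! ### The geometric majorant of the tail of (5.6) -/

/-- `𝔘 ≥ 0`. [folklore] -/
theorem U_nonneg (hnn : ∀ n, 0 ≤ a n) (M n m : ℕ) : 0 ≤ (tildeCoef m n * (beta (Real.sqrt 2) / 2) ^ m * (Real.sqrt 2 / 2) ^ (m + n) * (a M * a 1 ^ (m + n - M))) := by
  have := beta_sqrt_two_pos
  exact mul_nonneg (mul_nonneg (mul_nonneg (tildeCoef_nonneg _ _) (by positivity)) (by positivity))
    (mul_nonneg (hnn M) (pow_nonneg (hnn 1) _))

/-- Termwise domination of the tail ((5.25)–(5.27)): `((beta (Real.sqrt 2) / 2) ^ m * bOf a (m + n) * tildeCoef m n) ≤ (tildeCoef m n * (beta (Real.sqrt 2) / 2) ^ m * (Real.sqrt 2 / 2) ^ (m + n) * (a M * a 1 ^ (m + n - M)))` once `m + n > 2M`.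
[cite: HaraHattoriWatanabe2001, §5.2 eqs. (5.25)–(5.27)] -/
theorem term_le_U (h0 : a 0 = 1) (hnn : ∀ n, 0 ≤ a n) (hA6 : ∀ m n, a (m + n) ≤ a m * a n)
    {M n m : ℕ} (hm : 2 * M < m + n) : ((beta (Real.sqrt 2) / 2) ^ m * bOf a (m + n) * tildeCoef m n) ≤ (tildeCoef m n * (beta (Real.sqrt 2) / 2) ^ m * (Real.sqrt 2 / 2) ^ (m + n) * (a M * a 1 ^ (m + n - M))) := by
  have := beta_sqrt_two_pos
  have hc : 0 ≤ (beta (Real.sqrt 2) / 2) ^ m * tildeCoef m n :=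
    mul_nonneg (by positivity) (tildeCoef_nonneg _ _)
  calc ((beta (Real.sqrt 2) / 2) ^ m * bOf a (m + n) * tildeCoef m n) = ((beta (Real.sqrt 2) / 2) ^ m * tildeCoef m n) * bOf a (m + n) := by ring
    _ ≤ ((beta (Real.sqrt 2) / 2) ^ m * tildeCoef m n) * ((Real.sqrt 2 / 2) ^ (m + n) * (a M * a 1 ^ (m + n - M))) :=
        mul_le_mul_of_nonneg_left (bOf_le_of_submul h0 hnn hA6 hm) hc
    _ = (tildeCoef m n * (beta (Real.sqrt 2) / 2) ^ m * (Real.sqrt 2 / 2) ^ (m + n) * (a M * a 1 ^ (m + n - M))) := by ring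

/-- The recursion of the weights of (5.6): `tildeCoef (m+1) n = tildeCoef m n · 2(2n+2m+1)/(m+1)`.
[folklore] -/
theorem tildeCoef_succ (n m : ℕ) :
    tildeCoef (m + 1) n = tildeCoef m n * (2 * (2 * n + 2 * m + 1)) / (m + 1) := by
  rw [tildeCoef_eq_wnum_div, tildeCoef_eq_wnum_div, wnum_succ, Nat.factorial_succ]
  push_cast
  have : (m.factorial : ℝ) ≠ 0 := by positivity
  field_simp

/-- The ratio of consecutive majorants ((5.27)): `𝔘_{m+1} = 𝔘_m · (2n+2m+1)/(m+1) · (βc a_1/2)`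
when `m + n ≥ M`. [cite: HaraHattoriWatanabe2001, §5.2 eq. (5.27)] -/
theorem U_succ (M n m : ℕ) (hm : M ≤ m + n) :
    (tildeCoef (m + 1) n * (beta (Real.sqrt 2) / 2) ^ (m + 1) * (Real.sqrt 2 / 2) ^ (m + 1 + n) * (a M * a 1 ^ (m + 1 + n - M))) = (tildeCoef m n * (beta (Real.sqrt 2) / 2) ^ m * (Real.sqrt 2 / 2) ^ (m + n) * (a M * a 1 ^ (m + n - M))) *
      ((2 * n + 2 * m + 1) / (m + 1) * (beta (Real.sqrt 2) * Real.sqrt 2 * a 1 / 2)) := by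
  rw [tildeCoef_succ, show m + 1 + n - M = (m + n - M) + 1 by omega,
    show m + 1 + n = (m + n) + 1 by omega, pow_succ, pow_succ, pow_succ]
  have : ((m : ℝ) + 1) ≠ 0 := by positivity
  field_simp

/-- The eventual ratio bound: `(2n+2m+1)/(m+1) ≤ ρ(n,m₁)` for `m ≥ m₁` (`ρ = 2` if `n = 0`, else
the ratio at `m₁`, which is non-increasing in `m` for `n ≥ 1`). [folklore] -/
theorem ratio_le_ratioBound (n m1 m : ℕ) (hm : m1 ≤ m) :
    ((2 * n + 2 * m + 1 : ℝ) / (m + 1)) ≤ (if n = 0 then (2 : ℝ) else ((2 * n + 2 * m1 + 1 : ℝ) / (m1 + 1))) := by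
  split_ifs with hn
  · subst hn
    rw [div_le_iff₀ (by positivity)]; push_cast; linarith
  · have hn1 : 1 ≤ n := Nat.one_le_iff_ne_zero.mpr hn
    rw [div_le_div_iff₀ (by positivity) (by positivity)]
    have hm' : (m1 : ℝ) ≤ m := by exact_mod_cast hm
    have hn' : (1 : ℝ) ≤ n := by exact_mod_cast hn1
    nlinarith

/-- `ρ ≥ 0`. [folklore] -/
theorem ratioBound_nonneg (n m1 : ℕ) : 0 ≤ (if n = 0 then (2 : ℝ) else ((2 * n + 2 * m1 + 1 : ℝ) / (m1 + 1))) := by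
  split_ifs <;> positivity

/-- Geometric decay of the majorants beyond `m₁ ≥ M` ((5.27)–(5.28)): with
`q₀ = ρ(n,m₁) βc a_1/2`, `𝔘_{m₁+j} ≤ 𝔘_{m₁} q₀^j`. [cite: HaraHattoriWatanabe2001, §5.2 eqs. (5.27)–(5.28)] -/
theorem U_le_geom (hnn : ∀ n, 0 ≤ a n) {M n m1 : ℕ} (hm1 : M ≤ m1) (j : ℕ) :
    (tildeCoef (m1 + j) n * (beta (Real.sqrt 2) / 2) ^ (m1 + j) * (Real.sqrt 2 / 2) ^ (m1 + j + n) * (a M * a 1 ^ (m1 + j + n - M))) ≤ (tildeCoef m1 n * (beta (Real.sqrt 2) / 2) ^ m1 * (Real.sqrt 2 / 2) ^ (m1 + n) * (a M * a 1 ^ (m1 + n - M))) * ((if n = 0 then (2 : ℝ) else ((2 * n + 2 * m1 + 1 : ℝ) / (m1 + 1))) * (beta (Real.sqrt 2) * Real.sqrt 2 * a 1 / 2)) ^ j := by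
  have hβ := beta_sqrt_two_pos
  have h1 : 0 ≤ a 1 := hnn 1
  have hκ : 0 ≤ beta (Real.sqrt 2) * Real.sqrt 2 * a 1 / 2 := by positivity
  have hρ : 0 ≤ (if n = 0 then (2 : ℝ) else ((2 * n + 2 * m1 + 1 : ℝ) / (m1 + 1))) * (beta (Real.sqrt 2) * Real.sqrt 2 * a 1 / 2) :=
    mul_nonneg (ratioBound_nonneg n m1) hκ
  induction j with
  | zero => simp
  | succ j ih =>
    rw [← add_assoc, U_succ M n (m1 + j) (by omega), pow_succ]
    have hr := ratio_le_ratioBound n m1 (m1 + j) (by omega)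
    have hU := U_nonneg hnn M n (m1 + j)
    calc (tildeCoef (m1 + j) n * (beta (Real.sqrt 2) / 2) ^ (m1 + j) * (Real.sqrt 2 / 2) ^ (m1 + j + n) * (a M * a 1 ^ (m1 + j + n - M))) * ((2 * n + 2 * (m1 + j : ℕ) + 1) / ((m1 + j : ℕ) + 1) *
          (beta (Real.sqrt 2) * Real.sqrt 2 * a 1 / 2))
        ≤ (tildeCoef (m1 + j) n * (beta (Real.sqrt 2) / 2) ^ (m1 + j) * (Real.sqrt 2 / 2) ^ (m1 + j + n) * (a M * a 1 ^ (m1 + j + n - M))) * ((if n = 0 then (2 : ℝ) else ((2 * n + 2 * m1 + 1 : ℝ) / (m1 + 1))) * (beta (Real.sqrt 2) * Real.sqrt 2 * a 1 / 2)) := by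
          apply mul_le_mul_of_nonneg_left _ hU
          push_cast at hr ⊢
          exact mul_le_mul_of_nonneg_right hr hκ
      _ ≤ (tildeCoef m1 n * (beta (Real.sqrt 2) / 2) ^ m1 * (Real.sqrt 2 / 2) ^ (m1 + n) * (a M * a 1 ^ (m1 + n - M))) * ((if n = 0 then (2 : ℝ) else ((2 * n + 2 * m1 + 1 : ℝ) / (m1 + 1))) * (beta (Real.sqrt 2) * Real.sqrt 2 * a 1 / 2)) ^ j *
          ((if n = 0 then (2 : ℝ) else ((2 * n + 2 * m1 + 1 : ℝ) / (m1 + 1))) * (beta (Real.sqrt 2) * Real.sqrt 2 * a 1 / 2)) :=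
          mul_le_mul_of_nonneg_right ih hρ
      _ = _ := by ring

/-- Summability and the geometric bound of the far tail ((5.28)): if `q₀ ≤ q < 1` then
`Σ_j 𝔘_{m₁+j}` converges and is at most `𝔘_{m₁}/(1-q)`. [cite: HaraHattoriWatanabe2001, §5.2 eq. (5.28)] -/
theorem tsum_U_le (hnn : ∀ n, 0 ≤ a n) {M n m1 : ℕ} (hm1 : M ≤ m1) {q : ℝ}
    (hq : (if n = 0 then (2 : ℝ) else ((2 * n + 2 * m1 + 1 : ℝ) / (m1 + 1))) * (beta (Real.sqrt 2) * Real.sqrt 2 * a 1 / 2) ≤ q) (hq1 : q < 1) :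
    Summable (fun j => (tildeCoef (m1 + j) n * (beta (Real.sqrt 2) / 2) ^ (m1 + j) * (Real.sqrt 2 / 2) ^ (m1 + j + n) * (a M * a 1 ^ (m1 + j + n - M)))) ∧ ∑' j, (tildeCoef (m1 + j) n * (beta (Real.sqrt 2) / 2) ^ (m1 + j) * (Real.sqrt 2 / 2) ^ (m1 + j + n) * (a M * a 1 ^ (m1 + j + n - M))) ≤ (tildeCoef m1 n * (beta (Real.sqrt 2) / 2) ^ m1 * (Real.sqrt 2 / 2) ^ (m1 + n) * (a M * a 1 ^ (m1 + n - M))) / (1 - q) := by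
  have hβ := beta_sqrt_two_pos
  have h1 : 0 ≤ a 1 := hnn 1
  have hq0nn : 0 ≤ (if n = 0 then (2 : ℝ) else ((2 * n + 2 * m1 + 1 : ℝ) / (m1 + 1))) * (beta (Real.sqrt 2) * Real.sqrt 2 * a 1 / 2) :=
    mul_nonneg (ratioBound_nonneg n m1) (by positivity)
  have hqnn : 0 ≤ q := hq0nn.trans hq
  have hgeom : Summable fun j : ℕ => (tildeCoef m1 n * (beta (Real.sqrt 2) / 2) ^ m1 * (Real.sqrt 2 / 2) ^ (m1 + n) * (a M * a 1 ^ (m1 + n - M))) * q ^ j :=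
    (summable_geometric_of_lt_one hqnn hq1).mul_left _
  have hle : ∀ j, (tildeCoef (m1 + j) n * (beta (Real.sqrt 2) / 2) ^ (m1 + j) * (Real.sqrt 2 / 2) ^ (m1 + j + n) * (a M * a 1 ^ (m1 + j + n - M))) ≤ (tildeCoef m1 n * (beta (Real.sqrt 2) / 2) ^ m1 * (Real.sqrt 2 / 2) ^ (m1 + n) * (a M * a 1 ^ (m1 + n - M))) * q ^ j := fun j =>
    (U_le_geom hnn hm1 j).trans
      (mul_le_mul_of_nonneg_left (pow_le_pow_left₀ hq0nn hq j) (U_nonneg hnn _ _ _))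
  have hsum : Summable fun j => (tildeCoef (m1 + j) n * (beta (Real.sqrt 2) / 2) ^ (m1 + j) * (Real.sqrt 2 / 2) ^ (m1 + j + n) * (a M * a 1 ^ (m1 + j + n - M))) :=
    Summable.of_nonneg_of_le (fun j => U_nonneg hnn _ _ _) hle hgeom
  refine ⟨hsum, ?_⟩
  calc ∑' j, (tildeCoef (m1 + j) n * (beta (Real.sqrt 2) / 2) ^ (m1 + j) * (Real.sqrt 2 / 2) ^ (m1 + j + n) * (a M * a 1 ^ (m1 + j + n - M))) ≤ ∑' j, (tildeCoef m1 n * (beta (Real.sqrt 2) / 2) ^ m1 * (Real.sqrt 2 / 2) ^ (m1 + n) * (a M * a 1 ^ (m1 + n - M))) * q ^ j := hsum.tsum_le_tsum hle hgeom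
    _ = (tildeCoef m1 n * (beta (Real.sqrt 2) / 2) ^ m1 * (Real.sqrt 2 / 2) ^ (m1 + n) * (a M * a 1 ^ (m1 + n - M))) * ∑' j : ℕ, q ^ j := by rw [tsum_mul_left]
    _ = (tildeCoef m1 n * (beta (Real.sqrt 2) / 2) ^ m1 * (Real.sqrt 2 / 2) ^ (m1 + n) * (a M * a 1 ^ (m1 + n - M))) / (1 - q) := by rw [tsum_geometric_of_lt_one hqnn hq1, ← div_eq_mul_inv]

/-- **Summability of (5.6) and the tail estimate.** Under `a_0 = 1`, `a_n ≥ 0`, (A.6): with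
`m₀ + n > 2M`, `M ≤ m₀ ≤ m₁` and a ratio bound `q < 1` at `m₁`, the series `Σ_m ((beta (Real.sqrt 2) / 2) ^ m * bOf a (m + n) * tildeCoef m n)`
converges, and its tail from `m₀` is at most `Σ_{m₀ ≤ m < m₁} 𝔘_m + 𝔘_{m₁}/(1-q)`.
[cite: HaraHattoriWatanabe2001, §5.2 eqs. (5.25)–(5.29)] -/
theorem summable_and_tail_le (h0 : a 0 = 1) (hnn : ∀ n, 0 ≤ a n) (hA6 : ∀ m n, a (m + n) ≤ a m * a n)
    {M n m0 m1 : ℕ} (hm0 : 2 * M < m0 + n) (hM0 : M ≤ m0) (h01 : m0 ≤ m1) {q : ℝ}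
    (hq : (if n = 0 then (2 : ℝ) else ((2 * n + 2 * m1 + 1 : ℝ) / (m1 + 1))) * (beta (Real.sqrt 2) * Real.sqrt 2 * a 1 / 2) ≤ q) (hq1 : q < 1) :
    Summable (fun m => ((beta (Real.sqrt 2) / 2) ^ m * bOf a (m + n) * tildeCoef m n)) ∧
      ∑' j, ((beta (Real.sqrt 2) / 2) ^ (m0 + j) * bOf a (m0 + j + n) * tildeCoef (m0 + j) n) ≤ ∑ j ∈ range (m1 - m0), (tildeCoef (m0 + j) n * (beta (Real.sqrt 2) / 2) ^ (m0 + j) * (Real.sqrt 2 / 2) ^ (m0 + j + n) * (a M * a 1 ^ (m0 + j + n - M))) + (tildeCoef m1 n * (beta (Real.sqrt 2) / 2) ^ m1 * (Real.sqrt 2 / 2) ^ (m1 + n) * (a M * a 1 ^ (m1 + n - M))) / (1 - q) := by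
  obtain ⟨hsumU1, hU1⟩ := tsum_U_le hnn (hM0.trans h01) hq hq1
  have hsumU0 : Summable fun j => (tildeCoef (m0 + j) n * (beta (Real.sqrt 2) / 2) ^ (m0 + j) * (Real.sqrt 2 / 2) ^ (m0 + j + n) * (a M * a 1 ^ (m0 + j + n - M))) := by
    have : Summable fun j => (tildeCoef (m0 + (j + (m1 - m0))) n * (beta (Real.sqrt 2) / 2) ^ (m0 + (j + (m1 - m0))) * (Real.sqrt 2 / 2) ^ (m0 + (j + (m1 - m0)) + n) * (a M * a 1 ^ (m0 + (j + (m1 - m0)) + n - M))) := by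
      refine hsumU1.congr fun j => ?_
      rw [show m0 + (j + (m1 - m0)) = m1 + j by omega]
    exact (summable_nat_add_iff (f := fun j => (tildeCoef (m0 + j) n * (beta (Real.sqrt 2) / 2) ^ (m0 + j) * (Real.sqrt 2 / 2) ^ (m0 + j + n) * (a M * a 1 ^ (m0 + j + n - M)))) (m1 - m0)).mp this
  have hle0 : ∀ j, ((beta (Real.sqrt 2) / 2) ^ (m0 + j) * bOf a (m0 + j + n) * tildeCoef (m0 + j) n) ≤ (tildeCoef (m0 + j) n * (beta (Real.sqrt 2) / 2) ^ (m0 + j) * (Real.sqrt 2 / 2) ^ (m0 + j + n) * (a M * a 1 ^ (m0 + j + n - M))) := fun j => term_le_U h0 hnn hA6 (by omega)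
  have hsumT0 : Summable fun j => ((beta (Real.sqrt 2) / 2) ^ (m0 + j) * bOf a (m0 + j + n) * tildeCoef (m0 + j) n) :=
    Summable.of_nonneg_of_le (fun j => term_nonneg hnn _ _) hle0 hsumU0
  have hsumT : Summable (fun m => ((beta (Real.sqrt 2) / 2) ^ m * bOf a (m + n) * tildeCoef m n)) := by
    have : Summable fun j => ((beta (Real.sqrt 2) / 2) ^ (j + m0) * bOf a (j + m0 + n) * tildeCoef (j + m0) n) := hsumT0.congr fun j => by rw [add_comm]
    exact (summable_nat_add_iff m0).mp this
  refine ⟨hsumT, ?_⟩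
  calc ∑' j, ((beta (Real.sqrt 2) / 2) ^ (m0 + j) * bOf a (m0 + j + n) * tildeCoef (m0 + j) n) ≤ ∑' j, (tildeCoef (m0 + j) n * (beta (Real.sqrt 2) / 2) ^ (m0 + j) * (Real.sqrt 2 / 2) ^ (m0 + j + n) * (a M * a 1 ^ (m0 + j + n - M))) := hsumT0.tsum_le_tsum hle0 hsumU0
    _ = ∑ j ∈ range (m1 - m0), (tildeCoef (m0 + j) n * (beta (Real.sqrt 2) / 2) ^ (m0 + j) * (Real.sqrt 2 / 2) ^ (m0 + j + n) * (a M * a 1 ^ (m0 + j + n - M))) + ∑' j, (tildeCoef (m0 + (j + (m1 - m0))) n * (beta (Real.sqrt 2) / 2) ^ (m0 + (j + (m1 - m0))) * (Real.sqrt 2 / 2) ^ (m0 + (j + (m1 - m0)) + n) * (a M * a 1 ^ (m0 + (j + (m1 - m0)) + n - M))) :=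
        (hsumU0.sum_add_tsum_nat_add (m1 - m0)).symm
    _ = ∑ j ∈ range (m1 - m0), (tildeCoef (m0 + j) n * (beta (Real.sqrt 2) / 2) ^ (m0 + j) * (Real.sqrt 2 / 2) ^ (m0 + j + n) * (a M * a 1 ^ (m0 + j + n - M))) + ∑' j, (tildeCoef (m1 + j) n * (beta (Real.sqrt 2) / 2) ^ (m1 + j) * (Real.sqrt 2 / 2) ^ (m1 + j + n) * (a M * a 1 ^ (m1 + j + n - M))) := by
        congr 1; refine tsum_congr fun j => ?_; rw [show m0 + (j + (m1 - m0)) = m1 + j by omega]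
    _ ≤ ∑ j ∈ range (m1 - m0), (tildeCoef (m0 + j) n * (beta (Real.sqrt 2) / 2) ^ (m0 + j) * (Real.sqrt 2 / 2) ^ (m0 + j + n) * (a M * a 1 ^ (m0 + j + n - M))) + (tildeCoef m1 n * (beta (Real.sqrt 2) / 2) ^ m1 * (Real.sqrt 2 / 2) ^ (m1 + n) * (a M * a 1 ^ (m1 + n - M))) / (1 - q) := by gcongr

/-! ### Reading the tables -/

/-- Access to a tabulated function (any type). [folklore] -/
theorem getD_map_range {α : Type*} (f : ℕ → α) (d : α) {K i : ℕ} (hi : i < K) :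
    ((List.range K).map f).getD i d = f i := by
  simp [List.getD_eq_getElem?_getD, List.getElem?_map, List.getElem?_range hi]

namespace Cfg

variable (C : Cfg)

/-- Table read: `c4L`. [folklore] -/
theorem mkTab_c4L {n : ℕ} (hn : n < 2 * C.M + 1) : get C.mkTab.c4L n = C.c4L n :=
  get_map_range _ hn

/-- Table read: `c4H`. [folklore] -/
theorem mkTab_c4H {n : ℕ} (hn : n < 2 * C.M + 1) : get C.mkTab.c4H n = C.c4H n :=
  get_map_range _ hn

/-- Table read: binomials. [folklore] -/
theorem mkTab_binom {n l : ℕ} (hn : n < 2 * C.M + 1) (hl : l < n + 1) :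
    get2 C.mkTab.binom n l = n.choose l := by
  unfold mkTab
  rw [get2_map_range _ hn, getD_map_range _ _ hl, binom_eq]

/-- Table read: `wbL`. [folklore] -/
theorem mkTab_wbL {n m : ℕ} (hn : n < C.M + 1) (hm : m < 2 * C.M + 1 - n) :
    get2 C.mkTab.wbL n m = C.wbL n m := by
  unfold mkTab
  rw [get2_map_range _ hn, getD_map_range _ _ hm]

/-- Table read: `wbH`. [folklore] -/
theorem mkTab_wbH {n m : ℕ} (hn : n < C.M + 1) (hm : m < 2 * C.M + 1 - n) :
    get2 C.mkTab.wbH n m = C.wbH n m := by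
  unfold mkTab
  rw [get2_map_range _ hn, getD_map_range _ _ hm]

/-- Table read: `twH` (stored with the offset `m₀ = 2M+1-n`). [folklore] -/
theorem mkTab_twH {n j : ℕ} (hn : n < C.M + 1) (hj : j < C.M + n + 1) :
    get2 C.mkTab.twH n j = C.twH n (2 * C.M + 1 - n + j) := by
  unfold mkTab
  rw [get2_map_range _ hn, getD_map_range _ _ hj]

/-! ### The `S` step against the enclosures -/

variable {C}
variable {lo hi : List ℕ}

/-- The extended lower table is a lower bound everywhere. [folklore] -/
theorem loExt_le (hE : C.Encl lo hi a) (hnn : ∀ n, 0 ≤ a n) (l : ℕ) : (C.loExt lo l : ℝ) ≤ a l * C.one := by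
  unfold loExt
  split_ifs with hl
  · exact (hE l hl).1
  · push_cast; exact mul_nonneg (hnn l) C.one_pos.le

/-- The extended upper table is an upper bound up to `2M` ((A.6)). [cite: HaraHattoriWatanabe2001, Appendix A eq. (A.6)] -/
theorem le_hiExt (hE : C.Encl lo hi a) (hnn : ∀ n, 0 ≤ a n) (hA6 : ∀ m n, a (m + n) ≤ a m * a n)
    {l : ℕ} (hl : l ≤ 2 * C.M) : a l * C.one ≤ (C.hiExt hi l : ℝ) := by
  unfold hiExt
  split_ifs with hlM
  · exact (hE l hlM).2
  · push Not at hlM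
    have e : l = C.M + (l - C.M) := by omega
    calc a l * C.one = a (C.M + (l - C.M)) * C.one := by rw [← e]
      _ ≤ a C.M * a (l - C.M) * C.one := mul_le_mul_of_nonneg_right (hA6 _ _) C.one_pos.le
      _ ≤ _ := C.mulH_ge (hnn _) (hnn _) (hE _ le_rfl).2 (hE _ (by omega)).2

/-- **Lower `S` bound**: `bLo n ≤ b_n 2^P` for `n ≤ 2M`. [cite: HaraHattoriWatanabe2001, §5.2 eq. (5.8) and Proposition 5.1] -/
theorem bLo_le (hs : C.sqrtOK = true) (hE : C.Encl lo hi a) (hnn : ∀ n, 0 ≤ a n) {n : ℕ}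
    (hn : n ≤ 2 * C.M) : (C.bLo C.mkTab lo n : ℝ) ≤ bOf a n * C.one := by
  have hO := C.one_pos
  unfold bLo
  rw [C.mkTab_c4L (by omega), nsum_eq]
  set S := ∑ l ∈ range (n + 1), (n.choose l : ℝ) * a l * a (n - l) with hS
  have hF : ((∑ l ∈ range (n + 1), get2 C.mkTab.binom n l * C.loExt lo l * C.loExt lo (n - l) : ℕ) : ℝ)
      ≤ C.one ^ 2 * S := by
    rw [hS, mul_sum]
    push_cast
    refine sum_le_sum fun l hl => ?_
    have hl' : l < n + 1 := by simpa using hl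
    rw [C.mkTab_binom (by omega) hl']
    have h1 := loExt_le hE hnn l
    have h2 := loExt_le hE hnn (n - l)
    calc (n.choose l : ℝ) * (C.loExt lo l : ℕ) * (C.loExt lo (n - l) : ℕ)
        ≤ (n.choose l : ℝ) * (a l * C.one) * (a (n - l) * C.one) := by
          apply mul_le_mul (mul_le_mul_of_nonneg_left h1 (by positivity)) h2 (by positivity)
          exact mul_nonneg (by positivity) (mul_nonneg (hnn _) hO.le)
      _ = C.one ^ 2 * ((n.choose l : ℝ) * a l * a (n - l)) := by ring
  have hc := C.c4L_sound hs n
  calc (((C.c4L n * ∑ l ∈ range (n + 1), get2 C.mkTab.binom n l * C.loExt lo l * C.loExt lo (n - l)) /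
        (C.one * C.one) : ℕ) : ℝ)
      ≤ ((C.c4L n : ℕ) : ℝ) * ((∑ l ∈ range (n + 1),
          get2 C.mkTab.binom n l * C.loExt lo l * C.loExt lo (n - l) : ℕ) : ℝ) / (C.one * C.one) := by
        have := Nat.cast_div_le (α := ℝ) (m := C.c4L n * ∑ l ∈ range (n + 1),
          get2 C.mkTab.binom n l * C.loExt lo l * C.loExt lo (n - l)) (n := C.one * C.one)
        push_cast at this ⊢
        exact this
    _ ≤ ((Real.sqrt 2 / 4) ^ n * C.one) * (C.one ^ 2 * S) / (C.one * C.one) := by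
        apply div_le_div_of_nonneg_right _ (by positivity)
        exact mul_le_mul hc hF (by positivity) (by positivity)
    _ = bOf a n * C.one := by rw [bOf, ← hS]; field_simp

/-- **Upper `S` bound**: `b_n 2^P ≤ bHi n` for `n ≤ 2M`. [cite: HaraHattoriWatanabe2001, §5.2 eq. (5.9) and Proposition 5.1] -/
theorem le_bHi (hs : C.sqrtOK = true) (hE : C.Encl lo hi a) (hnn : ∀ n, 0 ≤ a n)
    (hA6 : ∀ m n, a (m + n) ≤ a m * a n) {n : ℕ} (hn : n ≤ 2 * C.M) :
    bOf a n * C.one ≤ (C.bHi C.mkTab hi n : ℝ) := by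
  have hO := C.one_pos
  unfold bHi
  rw [C.mkTab_c4H (by omega), nsum_eq]
  set S := ∑ l ∈ range (n + 1), (n.choose l : ℝ) * a l * a (n - l) with hS
  have hSnn : 0 ≤ S := sum_nonneg fun l _ => mul_nonneg (mul_nonneg (by positivity) (hnn _)) (hnn _)
  have hF : C.one ^ 2 * S ≤
      ((∑ l ∈ range (n + 1), get2 C.mkTab.binom n l * C.hiExt hi l * C.hiExt hi (n - l) : ℕ) : ℝ) := by
    rw [hS, mul_sum]
    push_cast
    refine sum_le_sum fun l hl => ?_
    have hl' : l < n + 1 := by simpa using hl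
    rw [C.mkTab_binom (by omega) hl']
    have h1 := le_hiExt hE hnn hA6 (l := l) (by omega)
    have h2 := le_hiExt hE hnn hA6 (l := n - l) (by omega)
    calc C.one ^ 2 * ((n.choose l : ℝ) * a l * a (n - l))
        = (n.choose l : ℝ) * (a l * C.one) * (a (n - l) * C.one) := by ring
      _ ≤ (n.choose l : ℝ) * (C.hiExt hi l : ℕ) * (C.hiExt hi (n - l) : ℕ) := by
          apply mul_le_mul (mul_le_mul_of_nonneg_left h1 (by positivity)) h2
            (mul_nonneg (hnn _) hO.le) (by positivity)
  have hc := C.c4H_sound hs n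
  calc bOf a n * C.one = ((Real.sqrt 2 / 4) ^ n * C.one) * (C.one ^ 2 * S) / (C.one * C.one) := by
        rw [bOf, ← hS]; field_simp
    _ ≤ ((C.c4H n : ℕ) : ℝ) * ((∑ l ∈ range (n + 1),
          get2 C.mkTab.binom n l * C.hiExt hi l * C.hiExt hi (n - l) : ℕ) : ℝ) / (C.one * C.one) := by
        apply div_le_div_of_nonneg_right _ (by positivity)
        exact mul_le_mul hc hF (by positivity) (by positivity)
    _ = (((C.c4H n * ∑ l ∈ range (n + 1),
          get2 C.mkTab.binom n l * C.hiExt hi l * C.hiExt hi (n - l)) : ℕ) : ℝ) / ((C.one * C.one : ℕ) : ℝ) := by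
        push_cast; ring
    _ ≤ _ := div_le_cdiv _ (Nat.mul_pos C.one_pos_nat C.one_pos_nat)

end Cfg

end Literature.Barriers.CriticalPhenomena.HierarchicalRG.Thm22Cert

end
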